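import Summits.BirchSwinnertonDyer.Rank1Residual.X11b.Three.GaloisStableRestrict
import Summits.BirchSwinnertonDyer.Rank1Residual.X11b.Three.ImageAtThreeField
import HarnessLib

/-!
# X11b at `p = 3` (team N8/O2), E-K8 · IMG3-GEN instantiated for LINE K: over a HEEGNER field `K`
# of an X11b@3 ∧ Surj curve, a `Γ_K`-stable subgroup of `Hom(C, E[3^{k+1}])` detecting every
# `c ≠ 0` is everything (cell `b2b-bsdres`, team `x11b3`, seat p2)

HONEST FRAMING (verbatim, cell `b2b-bsdres`, run/shared/lean/b2b/bsd-rank1-residual/): the goal of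
the cell is to DELETE the COMBINATION-SHAPED residual classes for ALL analytic-rank `≤ 1` curves
over `ℚ` — "full BSD formula for every rank `≤ 1` curve in class `C`" assembled STRICTLY from
published theorems — so that the rank-`≤ 1` remainder becomes exactly the CONSTRUCTION-SHAPED
classes, which are TYPED (missing-input Props), NOT attempted; this is not "finishing BSD".
Research route (team N8/O2: STEP L at `3 ‖ N`, LINE K); ELEMENTARY Galois-module algebra; nothing
booked; no label touched; X11b@3 stays OPEN (RESIDUAL-MAP §I O2). THEOREMS ONLY; no definition;
no named fact; no `sorry`.

## What (E-K8's U2 core joined to x11b3-p1's S6 record `Three/ImageAtThreeField`)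

* `WeierstrassCurve.addSubgroup_hom_geomTorsion_eq_top_of_heegner` — `E/ℚ` with `ρ̄_{E,3}` onto,
  `K` imaginary quadratic satisfying the Heegner hypothesis for a level `N` with `3 ∣ N` (so
  `K ≠ ℚ(√−3)` and `ρ̄_{E,3}|_{Γ_K}` is onto: `Three.surjective_galoisRepTorsion_comp_absGaloisRestrict_of_heegner`),
  `C` a finite abelian group killed by `3^{k+1}`, `V ≤ Hom(C, E[3^{k+1}])` an additive subgroup
  stable under `f ↦ (γ • ·) ∘ f` for `γ ∈ Γ_K` (acting through `absGaloisRestrict ℚ K`) and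
  detecting every `c ≠ 0` ⟹ `V = Hom(C, E[3^{k+1}])`;
* `WeierstrassCurve.addSubgroup_hom_geomTorsion_eq_top_of_classX11b_heegner` — the same with the
  level supplied by `ClassX11b W 3` (`3 ∣ N_E`, `Three.dvd_conductorNorm_of_classX11b`) and the
  Heegner hypothesis for `N_E`.

This is McCallum §3 (2)'s surjectivity `Gal(L_C/L) ≅ Hom(C, E_{3^M})` MINUS its Galois-
cohomological identification (`V` = image of `Gal(L_C/L)`; detection from U1 = Sah, tree
`Three/GaloisImageNegOne`), at the team's `p = 3`. What this file is NOT: no Galois cohomology, no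
claim about any class; nothing booked.

References: W. G. McCallum, LMS LNS 153 (1991) §3 [McCallum1991]; J.-P. Serre, Invent. Math. 15
(1972) §IV [Serre1972]; team files `cells/x11b3/LINE-K.md` block 3 (U2), `cells/x11b3/PLAN.md`
§2 S6/S7.
-/

noncomputable section

open scoped Classical

open Field NumberField Literature.NumberTheory.EllipticCurves
  Literature.NumberTheory.EllipticCurves.Rank1Residual Literature.NumberTheory.GaloisRepresentations
  Summit.BirchSwinnertonDyer.Rank1Residual Summit.BirchSwinnertonDyer.Rank1Residual.X11b.Three

namespace WeierstrassCurve

/-- **U2 core over a Heegner field at `p = 3`.** `ρ̄_{E,3}` onto, `K` imaginary quadratic with the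
Heegner hypothesis for some `N` with `3 ∣ N`; `C` finite with `3^{k+1} C = 0`; a `Γ_K`-stable
additive subgroup `V ≤ Hom(C, E[3^{k+1}])` detecting every `c ≠ 0` is all of `Hom(C, E[3^{k+1}])`.
[folklore] -/
theorem addSubgroup_hom_geomTorsion_eq_top_of_heegner (W : WeierstrassCurve ℚ) [W.IsElliptic]
    (K : Type) [Field K] [NumberField K]
    (hsurj : W.HasSurjectiveModNGaloisRep (3 : ℕ)) (hK : IsImaginaryQuadratic K) {N : ℕ}
    (hH : SatisfiesHeegnerHypothesis N K) (h3N : 3 ∣ N) (k : ℕ)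
    {C : Type*} [AddCommGroup C] [Finite C] (hC : ∀ c : C, (3 ^ (k + 1)) • c = 0)
    (V : AddSubgroup (C →+ W.geomTorsion ((3 ^ (k + 1) : ℕ) : ℤ)))
    (hV : ∀ γ : absoluteGaloisGroup K, ∀ f ∈ V,
      (DistribSMul.toAddMonoidHom (W.geomTorsion ((3 ^ (k + 1) : ℕ) : ℤ))
        ((absGaloisRestrict ℚ K : absoluteGaloisGroup K →* absoluteGaloisGroup ℚ) γ)).comp f ∈ V)
    (hdet : ∀ c : C, c ≠ 0 → ∃ f ∈ V, f c ≠ 0) : V = ⊤ :=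
  haveI : Fact (Nat.Prime 3) := ⟨Nat.prime_three⟩
  W.addSubgroup_hom_geomTorsion_eq_top_of_surjective_comp 3 k (by norm_num)
    (absGaloisRestrict ℚ K : absoluteGaloisGroup K →* absoluteGaloisGroup ℚ)
    (surjective_galoisRepTorsion_comp_absGaloisRestrict_of_heegner W K hsurj hK hH h3N) hC V hV hdet

/-- **U2 core over a Heegner field of an X11b@3 ∧ Surj curve** (`3 ∣ N_E` from `ClassX11b W 3`;
the Heegner hypothesis for `N_E`). [folklore] -/
theorem addSubgroup_hom_geomTorsion_eq_top_of_classX11b_heegner (W : WeierstrassCurve ℚ)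
    [W.IsElliptic] [W.IsGloballyMinimal] [Fact (Nat.Prime 3)] (K : Type) [Field K] [NumberField K]
    (hX : ClassX11b W 3) (hsurj : Surj W 3) (hK : IsImaginaryQuadratic K)
    {N : ℕ} (hN : W.conductorNorm ℤ = N) (hH : SatisfiesHeegnerHypothesis N K) (k : ℕ)
    {C : Type*} [AddCommGroup C] [Finite C] (hC : ∀ c : C, (3 ^ (k + 1)) • c = 0)
    (V : AddSubgroup (C →+ W.geomTorsion ((3 ^ (k + 1) : ℕ) : ℤ)))
    (hV : ∀ γ : absoluteGaloisGroup K, ∀ f ∈ V,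
      (DistribSMul.toAddMonoidHom (W.geomTorsion ((3 ^ (k + 1) : ℕ) : ℤ))
        ((absGaloisRestrict ℚ K : absoluteGaloisGroup K →* absoluteGaloisGroup ℚ) γ)).comp f ∈ V)
    (hdet : ∀ c : C, c ≠ 0 → ∃ f ∈ V, f c ≠ 0) : V = ⊤ :=
  W.addSubgroup_hom_geomTorsion_eq_top_of_surjective_comp 3 k (by norm_num)
    (absGaloisRestrict ℚ K : absoluteGaloisGroup K →* absoluteGaloisGroup ℚ)
    (surjective_galoisRepTorsion_comp_absGaloisRestrict_of_classX11b W K hX hsurj hK hN hH)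
    hC V hV hdet

end WeierstrassCurve

end
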